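import Mathlib
import Summits.Ventures.HodgeRepro.Tier4.Common.AdelicDefs
import Summits.Ventures.HodgeRepro.Tier4.Common.AdelicRTF
import Summits.Ventures.HodgeRepro.Tier4.Common.MixedPlaneCusp
import Summits.Ventures.HodgeRepro.Tier4.Common.AdelicHaar
import Summits.Ventures.HodgeRepro.Tier4.Line1.CocompactReduction

/-!
# Tier4/Common/RTFDataWitness — the R4 witness of `RTFData` with `IsHaar` (shared by LINE L1 and LINE L4)

`RTFData W` (AdelicRTF) bundles two characters of the adelic tori `T(𝔸_k)`, `T′(𝔸_k)` of a plane `W`, two measures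
and two fundamental domains of the rational points; `RTFData.IsHaar` (MixedPlaneCusp) asks the measures to be Haar
and the domains to have positive finite measure.  The lead's R4 rule (S12285 / S12338) asks for a KERNEL WITNESS that
such data exist for a genuine plane.  This module gives it, with the ONE input that is a theorem of the literature
(the cocompactness of `T(k)` in `T(𝔸_k)` for the anisotropic torus — Borel–Harish-Chandra; for `U(1)` Neukirch VI
(1.6), t4-lit-5 row I-t4-lit-5-52) DISPLAYED as a hypothesis in exactly the shape LINE L1's `(I1-c′)/(I1-c″)`
reductions consume (`Line1.CocompactReduction`):

* the measures are Mathlib's Haar measures `Measure.haar` on the locally compact Hausdorff groups `torusT W`,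
  `torusT' W` (typer-2's `Common.AdelicHaar`: `locallyCompactSpace_torusT`, `locallyCompactSpace_torusT'`,
  `t2Space_M4`), for the Borel σ-algebra induced from `GA W`;
* the fundamental domains are t4-L1-p5's `torus_quotient_compact_of_cocompact` / `torus'_quotient_compact_of_cocompact`
  (a fundamental domain with compact closure, from a compact set meeting every orbit);
* `0 < μT DT` because a fundamental domain of a countable group (`rationalOf_countable`) carries the whole measure of
  the group in the sense of `IsFundamentalDomain.measure_eq_tsum`, and a Haar measure is open-positive;
* `μT DT < ⊤` because `DT` has compact closure and Haar measures are finite on compacts.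

Nothing is asserted about any particular plane: the theorem is universal in `W`, the characters and the
cocompactness witnesses; it is consumed by LINE L1 (`exists_rtfDatum_defined` takes an `R : RTFData pl` with
these properties) and by LINE L4 (the wall `mixed_two_torus` quantifies over `R : RTFData (seesawPlane …)` with
`R.IsHaar`).  No `instance` is declared.
-/

namespace Summit.Ventures.HodgeRepro.Tier4.Common

open NumberField Matrix Topology MeasureTheory
open scoped Pointwise

variable {k : Type} [Field k] [NumberField k] (W : PlaneData k)

/-- **A fundamental domain of a countable discrete group has positive Haar measure.**  For a Haar measure `μ` on a
topological group `G` and a Mathlib fundamental domain `D` of a countable subgroup `Γ` (acting by left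
multiplication), `0 < μ D`: otherwise `μ univ = ∑' γ, μ (γ • univ ∩ D) = ∑' γ, μ D = 0`, contradicting open-positivity. -/
theorem measure_pos_of_isFundamentalDomain {G : Type} [Group G] [TopologicalSpace G] [IsTopologicalGroup G]
    [MeasurableSpace G] [BorelSpace G] (Γ : Subgroup G) [Countable Γ] (μ : Measure G) [μ.IsHaarMeasure]
    (D : Set G) (hD : IsFundamentalDomain Γ D μ) : 0 < μ D := by
  rw [pos_iff_ne_zero]
  intro h0
  have huniv : μ (Set.univ : Set G) = ∑' γ : Γ, μ ((γ • (Set.univ : Set G)) ∩ D) :=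
    hD.measure_eq_tsum Set.univ
  have hzero : ∀ γ : Γ, μ ((γ • (Set.univ : Set G)) ∩ D) = 0 := fun γ =>
    measure_mono_null Set.inter_subset_right h0
  simp only [hzero, tsum_zero] at huniv
  exact Measure.IsOpenPosMeasure.open_pos (μ := μ) (Set.univ : Set G) isOpen_univ Set.univ_nonempty huniv

/-- **The R4 witness: Haar data on the two tori of a plane exist, for any pair of characters and any cocompactness
witnesses.**  The characters `chi`, `chi′` and their three clause-hypotheses are exactly the character fields of
`RTFData`; `hcc`, `hcc′` are the cocompactness of `T(k)` in `T(𝔸_k)` and of `T′(k)` in `T′(𝔸_k)` in the shape of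
`Line1.torus_quotient_compact_of_cocompact` (a compact set meeting every orbit) — the literature input, DISPLAYED. -/
theorem exists_rtfData_isHaar [MeasurableSpace (GA W)] [BorelSpace (GA W)]
    (chi : torusT W → ℂ) (chi' : torusT' W → ℂ)
    (hmul : ∀ s t : torusT W, chi (s * t) = chi s * chi t)
    (hmul' : ∀ s t : torusT' W, chi' (s * t) = chi' s * chi' t)
    (hrat : ∀ t : torusT W, (t : GA W) ∈ rationalPoints W → chi t = 1)
    (hrat' : ∀ t : torusT' W, (t : GA W) ∈ rationalPoints W → chi' t = 1)
    (hcentre : ∀ (z : GA W) (hz : z ∈ centre W),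
      chi ⟨z, centre_le_torusT W hz⟩ = chi' ⟨z, centre_le_torusT' W hz⟩)
    (hcc : ∃ C : Set (torusT W), IsCompact C ∧
      ∀ x : torusT W, ∃ γ : rationalOf W (torusT W), ∃ c ∈ C, x = (γ : torusT W) * c)
    (hcc' : ∃ C : Set (torusT' W), IsCompact C ∧
      ∀ x : torusT' W, ∃ γ : rationalOf W (torusT' W), ∃ c ∈ C, x = (γ : torusT' W) * c) :
    ∃ R : RTFData W, R.chi = chi ∧ R.chi' = chi' ∧ R.IsHaar := by
  haveI := locallyCompactSpace_torusT W
  haveI := locallyCompactSpace_torusT' W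
  haveI := t2Space_M4 k
  haveI := Line1.rationalOf_countable W (torusT W)
  haveI := Line1.rationalOf_countable W (torusT' W)
  let μT : Measure (torusT W) := Measure.haar
  let μT' : Measure (torusT' W) := Measure.haar
  obtain ⟨DT, hDT, hDTc⟩ := Line1.torus_quotient_compact_of_cocompact W μT hcc
  obtain ⟨DT', hDT', hDT'c⟩ := Line1.torus'_quotient_compact_of_cocompact W μT' hcc'
  refine ⟨⟨chi, chi', hmul, hmul', hrat, hrat', hcentre, μT, μT', DT, DT', hDT, hDT'⟩, rfl, rfl, ?_⟩
  refine ⟨inferInstance, inferInstance, ?_, ?_, ?_, ?_⟩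
  · exact measure_pos_of_isFundamentalDomain (rationalOf W (torusT W)) μT DT hDT
  · exact lt_of_le_of_lt (measure_mono subset_closure) hDTc.measure_lt_top
  · exact measure_pos_of_isFundamentalDomain (rationalOf W (torusT' W)) μT' DT' hDT'
  · exact lt_of_le_of_lt (measure_mono subset_closure) hDT'c.measure_lt_top

end Summit.Ventures.HodgeRepro.Tier4.Common
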